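/-
Copyright (c) 2026. All rights reserved.
Released under Apache 2.0 license as described in the file LICENSE.
Authors: abc-iut cell, seat abc-iut-L4-t6 (gen 9; row «P13viii′-NODAL-IV»).
-/
import Literature.AnabelianGeometry.AbsoluteAnabelian.AbsTopII.DehnTwistFixedSubgroupExotic
import Literature.AnabelianGeometry.AbsoluteAnabelian.AbsTopII.DehnTwistLoopEdgePair
import Literature.AnabelianGeometry.AbsoluteAnabelian.AbsTopII.DehnTwistLoopDecomposition
import HarnessLib

/-!
# [AbsTopII] Prop 1.3 (viii′) at the nodal Dehn-twist datum: the `I_v`-clause for ARBITRARY `Π_𝔾`-conjugates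

S. Mochizuki, *Topics in Absolute Anabelian Geometry II* [AbsTopII] (`MochizukiAbsTopII2013`; kurims manuscript
`paper:url-585b8d0ad0d9`), §1, Prop 1.3 (viii) p. 12, quoted verbatim: "Let `e`, `e'` be edges of `𝔾`.  If
`D_e ∩ D_{e'} ∩ Π_I ≠ {1}`, then one of the following two [mutually exclusive] properties holds: (1) `e = e'`; (2) `e`
and `e'` are distinct, but abut to the same vertex `v`, and `D_e ∩ D_{e'} ∩ Π_𝔾 = {1}`.  Moreover, in the situation
of (2), [for appropriate choices of conjugates of the various inertia and decomposition groups involved] we have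
`I_v = D_e ∩ D_{e'} ∩ Π_I`."  Typed statement of record (the primed row (viii′), i.e. this item read for `D_e` and a
`Π_𝔾`-conjugate of `D_{e'}`): `DPSCIndexData.Prop_1_3_viii'` (abc-iut-L4-t6 `InertiaGroupsScope`, p427207).
At the nodal datum `DehnTwist.dpsc i hi` (`Π_I = Π_H = F̂₂ ⋊_{shear^i} Ẑ`, one vertex, loop node `e` with `D_e = b^Ẑ ⋊ Ẑ`,
cusp `c` with `D_c = c^Ẑ × Ẑ`, `I_v = 1 ⋊ Ẑ`) the `Π_𝔾`-clause `D_e ∩ γD_cγ⁻¹ ∩ Π_𝔾 = 1` holds for every `γ`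
(abc-iut-f-069 p468661) and the configured pair `γ = 1` gives `D_e ∩ D_c = I_v` (abc-iut-L4-t6 gen 8, p473590); the
`I_v`-CLAUSE for arbitrary `γ ∈ Π_𝔾` — GAP row G-L4t6g8-2 — is the subject of this file.

PROOF-ONLY file (no definition), abc-iut-L4-t6 (gen 9).  Write `S_g := D_e ⊓ (g,1)·D_c·(g,1)⁻¹` (`g ∈ F̂₂`).
* §1 `inv_mul_shearPow_mem_cuspGp_forall` — **if `g⁻¹·shear^i(k)(g) ∈ Π_c` for ONE `k ≠ 1`, then for ALL `k'`**
  (the exotic fixed-subgroup theorem `shearPow_eq_self_iff_mem_vertGp` of `DehnTwistFixedSubgroupExotic` applied to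
  `g c₀ g⁻¹` and to the cocycle `g·shear^i(k')(g)⁻¹`, plus `C_{F̂₂}(Π_c) = Π_c`);
* §2 `S_eq_conj_range_inr` — **if `S_g` contains `(h,1)·(1,k)·(h,1)⁻¹` with `k ≠ 1` and `(h,1)·I_v·(h,1)⁻¹ ≤ D_e`, then
  `S_g = (h,1)·I_v·(h,1)⁻¹`**; cases `h = 1` (`S_g ∋ (1,k)`) and `h = a⁻¹` (`S_g ∋ (b^{ik}, k)`) UNCONDITIONAL;
* (sequel `DehnTwistLoopProp13viiiOfCT2.lean`) **`prop_1_3_viii'_dpsc_of_CT2`** — the typed `Prop_1_3_viii'` HOLDS at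
  `dpsc i hi` MODULO ONE displayed input
  «CT2»: `∀ u k x, k ≠ 1 → b^u ≠ 1 → b^u ≠ b^{ik} → shear^i(k) x = b^{-u} x b^{u} → x ∈ Π_e` (= the centraliser in
  `Π_𝔾` of a NON-FIBRE element `(b^u, k)` of the edge torus `D_e ≅ Ẑ²` lies in `b^Ẑ`; discrete shadow: Bass–Serre /
  centralisers in the graph manifold `F₂ ⋊_{Dehn} ℤ`, NOT in the tree); a non-trivial `z = (b^u,k) ∈ S_g` has `k ≠ 1`,
  and `u ∈ {0}`/`b^u = b^{ik}` are §2, while any other `u` makes `g c₀ g⁻¹` a CT2-fixed point inside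
  `b^Ẑ ∩ g c^Ẑ g⁻¹ = 1` — absurd.  So G-L4t6g8-2 is NARROWED to CT2 exactly.
HONEST FRAMING: classical profinite group theory at a constructed model (constructed ≠ geometric); everything in THIS
file is unconditional, the sequel closes the typed (viii′) only MODULO CT2; consistency evidence, not a discharge at
geometric data; nothing here bears on [IUTchIII] Cor 3.12; no side taken.
Doc v2 (abc-iut-L4-t6 gen 12; referee finding ref-l L14-n4, site 1): the Prop 1.3 (viii) quotation above is now
print-verbatim (cases (1)/(2) and the full «Moreover»-bracket restored); every declaration below is byte-identical to
doc v1 (p487310).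
-/

noncomputable section

open scoped Pointwise

namespace Literature.AnabelianGeometry.AbsoluteAnabelian.AbsTopII.DehnTwist

open Literature.AnabelianGeometry.EtaleTheta.SettingModel
open Literature.AnabelianGeometry.EtaleTheta
open Function _root_.Topology

/-! ### §1 One twisted relation `g⁻¹·shear(g) ∈ Π_c` propagates to all twists -/

/-- `Π_c = c^Ẑ` is commutative. [cite: MochizukiAbsTopII2013, Prop 1.3 (vii) p.12] -/
theorem commute_of_mem_cuspGp {s t : F₂hatT} (hs : s ∈ cuspGp) (ht : t ∈ cuspGp) : s * t = t * s := by
  rw [cuspGp_eq_cAxis] at hs ht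
  obtain ⟨u, rfl⟩ := hs
  obtain ⟨v, rfl⟩ := ht
  change cPow u * cPow v = cPow v * cPow u
  rw [← map_mul, ← map_mul, ZHatCompletion.mul_comm]

/-- `C_{F̂₂}(Π_c) = Π_c` (centraliser ≤ normaliser `= c^Ẑ`, abc-iut-L4-t6 `normalizer_cAxis_eq`).
[cite: MochizukiAbsTopII2013, Prop 1.3 (vii) p.12] -/
theorem mem_cuspGp_of_mem_centralizer {x : F₂hatT} (hx : x ∈ Subgroup.centralizer (cuspGp : Set F₂hatT)) :
    x ∈ cuspGp := by
  rw [cuspGp_eq_cAxis] at hx ⊢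
  rw [← normalizer_cAxis_eq]
  exact Subgroup.centralizer_le_normalizer _ hx

/-- The twists commute: `shear^i(k) (shear^i(k') x) = shear^i(k') (shear^i(k) x)`.
[cite: MochizukiAbsTopII2013, Def 1.2 (ii) p.10] -/
theorem shearPow_comm (i : ℕ) (k k' : ZH) (x : F₂hatT) :
    shearPow i k (shearPow i k' x) = shearPow i k' (shearPow i k x) := by
  rw [← MulAut.mul_apply, ← map_mul, ZHatCompletion.mul_comm, map_mul, MulAut.mul_apply]

/-- **If `g⁻¹ · shear^i(k)(g) ∈ Π_c` for one `k ≠ 1`, then `g Π_c g⁻¹ ≤ Π_v`.**  (`shear^i(k)` acts on `g c₀ g⁻¹` by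
conjugation by `g c₁ g⁻¹`, `c₁ = g⁻¹ shear(g) ∈ Π_c` — trivially, `Π_c` being abelian; then the exotic fixed-subgroup
theorem.) [cite: MochizukiAbsTopII2013, Prop 1.3 (viii) p.12] -/
theorem conj_mem_vertGp_of_inv_mul_shearPow_mem_cuspGp {i : ℕ} (hi : 0 < i) {g : F₂hatT} {k : ZH} (hk : k ≠ 1)
    (h : g⁻¹ * shearPow i k g ∈ cuspGp) {c₀ : F₂hatT} (hc₀ : c₀ ∈ cuspGp) : g * c₀ * g⁻¹ ∈ vertGp := by
  rw [← shearPow_eq_self_iff_mem_vertGp hi hk]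
  have hσg : shearPow i k g = g * (g⁻¹ * shearPow i k g) := by group
  rw [map_mul, map_mul, map_inv, shearPow_mem_cuspGp i k c₀ hc₀, hσg]
  have hcomm := commute_of_mem_cuspGp h hc₀
  calc g * (g⁻¹ * shearPow i k g) * c₀ * (g * (g⁻¹ * shearPow i k g))⁻¹
      = g * ((g⁻¹ * shearPow i k g) * c₀) * (g⁻¹ * shearPow i k g)⁻¹ * g⁻¹ := by group
    _ = g * (c₀ * (g⁻¹ * shearPow i k g)) * (g⁻¹ * shearPow i k g)⁻¹ * g⁻¹ := by rw [hcomm]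
    _ = g * c₀ * g⁻¹ := by group

/-- **One relation for all: if `g⁻¹ · shear^i(k)(g) ∈ Π_c` for ONE `k ≠ 1`, then `g⁻¹ · shear^i(k')(g) ∈ Π_c` for EVERY
`k'`.**  The cocycle `φ(k') = g · shear^i(k')(g)⁻¹` is `shear^i(k)`-fixed, hence in `Π_v` (exotic fixed-subgroup theorem);
it commutes with `g Π_c g⁻¹ ≤ Π_v` (`φ(k') · shear^i(k')(y) · φ(k')⁻¹ = y` for `y = g c₀ g⁻¹`, and such `y` are
`shear`-fixed); so `g⁻¹ φ(k') g ∈ C(Π_c) = Π_c`. [cite: MochizukiAbsTopII2013, Prop 1.3 (viii) p.12] -/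
theorem inv_mul_shearPow_mem_cuspGp_forall {i : ℕ} (hi : 0 < i) {g : F₂hatT} {k : ZH} (hk : k ≠ 1)
    (h : g⁻¹ * shearPow i k g ∈ cuspGp) (k' : ZH) : g⁻¹ * shearPow i k' g ∈ cuspGp := by
  set c₁ := g⁻¹ * shearPow i k g with hc₁
  have hσg : shearPow i k g = g * c₁ := by rw [hc₁]; group
  -- the cocycle value `φ = g · shear(k')(g)⁻¹` is `shear(k)`-fixed
  set φ : F₂hatT := g * (shearPow i k' g)⁻¹ with hφ
  have hφfix : shearPow i k φ = φ := by
    rw [hφ, map_mul, map_inv, shearPow_comm i k k' g, hσg, map_mul, shearPow_mem_cuspGp i k' c₁ h]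
    group
  have hφv : φ ∈ vertGp := (shearPow_eq_self_iff_mem_vertGp hi hk φ).mp hφfix
  -- `g⁻¹ φ g` centralises `Π_c`
  have hcent : g⁻¹ * φ * g ∈ Subgroup.centralizer (cuspGp : Set F₂hatT) := by
    rw [Subgroup.mem_centralizer_iff]
    intro c₀ hc₀
    have hy : g * c₀ * g⁻¹ ∈ vertGp := conj_mem_vertGp_of_inv_mul_shearPow_mem_cuspGp hi hk h hc₀
    have hyfix : shearPow i k' (g * c₀ * g⁻¹) = g * c₀ * g⁻¹ := shearPow_mem_vertGp i k' _ hy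
    rw [map_mul, map_mul, map_inv, shearPow_mem_cuspGp i k' c₀ hc₀] at hyfix
    -- `hyfix : shear(k') g · c₀ · (shear(k') g)⁻¹ = g c₀ g⁻¹`
    have key : φ * (g * c₀ * g⁻¹) * φ⁻¹ = g * c₀ * g⁻¹ := by
      conv_lhs => rw [← hyfix]
      rw [hφ]
      group
    calc c₀ * (g⁻¹ * φ * g) = g⁻¹ * ((g * c₀ * g⁻¹) * φ) * g := by group
      _ = g⁻¹ * (φ * (g * c₀ * g⁻¹) * φ⁻¹ * φ) * g := by rw [key]
      _ = g⁻¹ * φ * g * c₀ := by group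
  have hmem : g⁻¹ * φ * g ∈ cuspGp := mem_cuspGp_of_mem_centralizer hcent
  rw [hφ] at hmem
  have : g⁻¹ * (g * (shearPow i k' g)⁻¹) * g = (g⁻¹ * shearPow i k' g)⁻¹ := by group
  rw [this] at hmem
  exact (Subgroup.inv_mem_iff _).mp hmem

/-! ### §2 The intersection `D_e ⊓ (g,1)·D_c·(g,1)⁻¹` in `Π_I` -/

section ExtLevel

variable (i : ℕ)

/-- Membership in a `Π_𝔾`-conjugate of `D_c = N(Π_c × 1)`: `z ∈ (g,1)·D_c·(g,1)⁻¹ ⟺ g⁻¹ · z.left · shear^i(z.right)(g) ∈ Π_c`.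
[cite: MochizukiAbsTopII2013, Prop 1.3 (viii) p.12] -/
theorem mem_conj_normalizer_cusp_iff (g : F₂hatT) (z : Ext i) :
    z ∈ MulAut.conj (SemidirectProduct.inl g : Ext i) •
        Subgroup.normalizer ((cuspGp.map (SemidirectProduct.inl : F₂hatT →* Ext i) : Subgroup (Ext i)) :
          Set (Ext i)) ↔
      g⁻¹ * z.left * shearPow i z.right g ∈ cuspGp := by
  rw [Subgroup.mem_pointwise_smul_iff_inv_smul_mem, MulAut.smul_def, MulAut.conj_inv_apply,
    normalizer_map_inl_cuspGp_eq, mem_map_inl_sup_range_inr_iff (shearPow_mem_cuspGp_of_mem i)]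
  simp only [SemidirectProduct.mul_left, SemidirectProduct.inv_left, SemidirectProduct.left_inl,
    SemidirectProduct.right_inl, SemidirectProduct.mul_right, SemidirectProduct.inv_right, inv_one, map_one,
    MulAut.one_apply, one_mul]

/-- Membership in `D_e = N(Π_e × 1)`: `z ∈ D_e ⟺ z.left ∈ Π_e = b^Ẑ`. [cite: MochizukiAbsTopII2013, Prop 1.3 (vii) p.12] -/
theorem mem_normalizer_node_iff (z : Ext i) :
    z ∈ Subgroup.normalizer ((nodeGp.map (SemidirectProduct.inl : F₂hatT →* Ext i) : Subgroup (Ext i)) :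
        Set (Ext i)) ↔ z.left ∈ nodeGp := by
  rw [normalizer_map_inl_nodeGp_eq, mem_map_inl_sup_range_inr_iff (shearPow_mem_nodeGp_of_mem i)]

variable {i} (hi : 0 < i)
include hi

/-- **The `I_v`-clause, structural form.**  If `S_g := D_e ⊓ (g,1)·D_c·(g,1)⁻¹` contains the conjugate
`(h,1)·(1,k)·(h,1)⁻¹` of a NON-TRIVIAL element of the twist section and the whole conjugate section
`(h,1)·(1 ⋊ Ẑ)·(h,1)⁻¹` lies in `D_e`, then `S_g` IS that conjugate section.  (§1 for `h⁻¹ g`; then two elements of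
`S_g` with the same `Ẑ`-coordinate differ by an element of `S_g ∩ Π_𝔾 = 1`, abc-iut-f-069 p468661.)
[cite: MochizukiAbsTopII2013, Prop 1.3 (viii) p.12] -/
theorem S_eq_conj_range_inr (g h : F₂hatT) {k : ZH} (hk : k ≠ 1)
    (hD : MulAut.conj (SemidirectProduct.inl h : Ext i) • (SemidirectProduct.inr : ZH →* Ext i).range ≤
      Subgroup.normalizer ((nodeGp.map (SemidirectProduct.inl : F₂hatT →* Ext i) : Subgroup (Ext i)) : Set (Ext i)))
    (hz : MulAut.conj (SemidirectProduct.inl h : Ext i) (SemidirectProduct.inr k) ∈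
      MulAut.conj (SemidirectProduct.inl g : Ext i) •
        Subgroup.normalizer ((cuspGp.map (SemidirectProduct.inl : F₂hatT →* Ext i) : Subgroup (Ext i)) :
          Set (Ext i))) :
    Subgroup.normalizer ((nodeGp.map (SemidirectProduct.inl : F₂hatT →* Ext i) : Subgroup (Ext i)) : Set (Ext i)) ⊓
        MulAut.conj (SemidirectProduct.inl g : Ext i) •
          Subgroup.normalizer ((cuspGp.map (SemidirectProduct.inl : F₂hatT →* Ext i) : Subgroup (Ext i)) :
            Set (Ext i)) =
      MulAut.conj (SemidirectProduct.inl h : Ext i) • (SemidirectProduct.inr : ZH →* Ext i).range := by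
  -- the conjugated twist section in coordinates
  have hconj : ∀ k' : ZH, (MulAut.conj (SemidirectProduct.inl h : Ext i)) (SemidirectProduct.inr k') =
      ⟨h * (shearPow i k' h)⁻¹, k'⟩ := by
    intro k'
    rw [MulAut.conj_apply]
    ext
    · simp only [SemidirectProduct.mul_left, SemidirectProduct.inv_left, SemidirectProduct.left_inl,
        SemidirectProduct.right_inl, SemidirectProduct.left_inr, SemidirectProduct.right_inr,
        SemidirectProduct.mul_right, map_one, MulAut.one_apply, mul_one, one_mul, inv_one, map_inv]
    · simp only [SemidirectProduct.mul_right, SemidirectProduct.inv_right, SemidirectProduct.right_inl,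
        SemidirectProduct.right_inr, one_mul, inv_one, mul_one]
  -- §1 applied to `g' = h⁻¹ g`
  have hrel : ∀ k' : ZH, (h⁻¹ * g)⁻¹ * shearPow i k' (h⁻¹ * g) ∈ cuspGp := by
    have h1 : (h⁻¹ * g)⁻¹ * shearPow i k (h⁻¹ * g) ∈ cuspGp := by
      rw [hconj, mem_conj_normalizer_cusp_iff] at hz
      have : (h⁻¹ * g)⁻¹ * shearPow i k (h⁻¹ * g) = g⁻¹ * (h * (shearPow i k h)⁻¹) * shearPow i k g := by
        rw [map_mul, map_inv]; group
      rw [this]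
      exact hz
    exact inv_mul_shearPow_mem_cuspGp_forall hi hk h1
  have hmemS : ∀ k' : ZH, (MulAut.conj (SemidirectProduct.inl h : Ext i)) (SemidirectProduct.inr k') ∈
      Subgroup.normalizer ((nodeGp.map (SemidirectProduct.inl : F₂hatT →* Ext i) : Subgroup (Ext i)) : Set (Ext i)) ⊓
        MulAut.conj (SemidirectProduct.inl g : Ext i) •
          Subgroup.normalizer ((cuspGp.map (SemidirectProduct.inl : F₂hatT →* Ext i) : Subgroup (Ext i)) :
            Set (Ext i)) := by
    intro k'
    refine Subgroup.mem_inf.mpr ⟨hD ?_, ?_⟩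
    · rw [Subgroup.mem_smul_pointwise_iff_exists]
      exact ⟨SemidirectProduct.inr k', ⟨k', rfl⟩, rfl⟩
    · rw [hconj, mem_conj_normalizer_cusp_iff]
      have : g⁻¹ * (h * (shearPow i k' h)⁻¹) * shearPow i k' g = (h⁻¹ * g)⁻¹ * shearPow i k' (h⁻¹ * g) := by
        rw [map_mul, map_inv]; group
      rw [this]
      exact hrel k'
  refine le_antisymm ?_ ?_
  · intro z hzS
    -- compare `z` with the element of the conjugate section having the same `Ẑ`-coordinate
    set z' : Ext i := (MulAut.conj (SemidirectProduct.inl h : Ext i)) (SemidirectProduct.inr z.right) with hz'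
    have hz'S := hmemS z.right
    have hq : z * z'⁻¹ ∈ (SemidirectProduct.inl : F₂hatT →* Ext i).range := by
      refine ⟨(z * z'⁻¹).left, ?_⟩
      conv_rhs => rw [← SemidirectProduct.inl_left_mul_inr_right (z * z'⁻¹)]
      have hr : (z * z'⁻¹).right = 1 := by
        rw [SemidirectProduct.mul_right, SemidirectProduct.inv_right, hz', hconj, mul_inv_cancel]
      rw [hr, map_one, mul_one]
    have hbot := normalizer_node_inf_conj_normalizer_cusp_inf_range_inl i (SemidirectProduct.inl g)
    have hmem : z * z'⁻¹ ∈ Subgroup.normalizer ((nodeGp.map (SemidirectProduct.inl : F₂hatT →* Ext i) :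
        Subgroup (Ext i)) : Set (Ext i)) ⊓ MulAut.conj (SemidirectProduct.inl g : Ext i) •
          Subgroup.normalizer ((cuspGp.map (SemidirectProduct.inl : F₂hatT →* Ext i) : Subgroup (Ext i)) :
            Set (Ext i)) ⊓ (SemidirectProduct.inl : F₂hatT →* Ext i).range :=
      Subgroup.mem_inf.mpr ⟨Subgroup.mul_mem _ hzS (Subgroup.inv_mem _ hz'S), hq⟩
    rw [hbot, Subgroup.mem_bot, mul_inv_eq_one] at hmem
    rw [hmem, hz', Subgroup.mem_smul_pointwise_iff_exists]
    exact ⟨SemidirectProduct.inr z.right, ⟨z.right, rfl⟩, rfl⟩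
  · intro z hzr
    rw [Subgroup.mem_smul_pointwise_iff_exists] at hzr
    obtain ⟨_, ⟨k', rfl⟩, rfl⟩ := hzr
    exact hmemS k'

/-- **Case `h = 1`: if `(1, k) ∈ S_g` for some `k ≠ 1` then `S_g = 1 ⋊ Ẑ = I_v`** — no hypothesis.
[cite: MochizukiAbsTopII2013, Prop 1.3 (viii) p.12] -/
theorem S_eq_range_inr_of_inr_mem (g : F₂hatT) {k : ZH} (hk : k ≠ 1)
    (hz : (SemidirectProduct.inr k : Ext i) ∈
      Subgroup.normalizer ((nodeGp.map (SemidirectProduct.inl : F₂hatT →* Ext i) : Subgroup (Ext i)) : Set (Ext i)) ⊓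
        MulAut.conj (SemidirectProduct.inl g : Ext i) •
          Subgroup.normalizer ((cuspGp.map (SemidirectProduct.inl : F₂hatT →* Ext i) : Subgroup (Ext i)) :
            Set (Ext i))) :
    Subgroup.normalizer ((nodeGp.map (SemidirectProduct.inl : F₂hatT →* Ext i) : Subgroup (Ext i)) : Set (Ext i)) ⊓
        MulAut.conj (SemidirectProduct.inl g : Ext i) •
          Subgroup.normalizer ((cuspGp.map (SemidirectProduct.inl : F₂hatT →* Ext i) : Subgroup (Ext i)) :
            Set (Ext i)) =
      (SemidirectProduct.inr : ZH →* Ext i).range := by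
  have h := S_eq_conj_range_inr hi g 1 hk (by
      rw [map_one, map_one, one_smul, normalizer_map_inl_nodeGp_eq]
      exact le_sup_right) (by
      rw [map_one, map_one, MulAut.one_apply]
      exact (Subgroup.mem_inf.mp hz).2)
  rw [map_one, map_one, one_smul] at h
  exact h

/-- **Case `h = a⁻¹`: if the second-branch element `(b^{k^i}, k) = (a,1)⁻¹(1,k)(a,1)` lies in `S_g` for some
`k ≠ 1`, then `S_g = (a,1)⁻¹ · I_v · (a,1)`** — no hypothesis. [cite: MochizukiAbsTopII2013, Prop 1.3 (viii) p.12] -/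
theorem S_eq_conj_genA_inv_range_inr_of_mem (g : F₂hatT) {k : ZH} (hk : k ≠ 1)
    (hz : (SemidirectProduct.inl (bPow (k ^ i)) * SemidirectProduct.inr k : Ext i) ∈
      Subgroup.normalizer ((nodeGp.map (SemidirectProduct.inl : F₂hatT →* Ext i) : Subgroup (Ext i)) : Set (Ext i)) ⊓
        MulAut.conj (SemidirectProduct.inl g : Ext i) •
          Subgroup.normalizer ((cuspGp.map (SemidirectProduct.inl : F₂hatT →* Ext i) : Subgroup (Ext i)) :
            Set (Ext i))) :
    Subgroup.normalizer ((nodeGp.map (SemidirectProduct.inl : F₂hatT →* Ext i) : Subgroup (Ext i)) : Set (Ext i)) ⊓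
        MulAut.conj (SemidirectProduct.inl g : Ext i) •
          Subgroup.normalizer ((cuspGp.map (SemidirectProduct.inl : F₂hatT →* Ext i) : Subgroup (Ext i)) :
            Set (Ext i)) =
      MulAut.conj (SemidirectProduct.inl genA : Ext i)⁻¹ • (SemidirectProduct.inr : ZH →* Ext i).range := by
  have hbranch : ∀ k' : ZH, (MulAut.conj (SemidirectProduct.inl genA⁻¹ : Ext i)) (SemidirectProduct.inr k') =
      SemidirectProduct.inl (bPow (k' ^ i)) * SemidirectProduct.inr k' := by
    intro k'
    rw [MulAut.conj_apply, map_inv, inv_inv]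
    exact inl_eta_zero_inv_mul_inr_mul i k'
  have h := S_eq_conj_range_inr hi g genA⁻¹ hk (by
      intro z hzm
      rw [Subgroup.mem_smul_pointwise_iff_exists] at hzm
      obtain ⟨_, ⟨k', rfl⟩, rfl⟩ := hzm
      rw [MulAut.smul_def, hbranch, mem_normalizer_node_iff, SemidirectProduct.mul_left, SemidirectProduct.left_inl,
        SemidirectProduct.right_inl, map_one, MulAut.one_apply, SemidirectProduct.left_inr, mul_one]
      exact ⟨_, rfl⟩) (by rw [hbranch]; exact (Subgroup.mem_inf.mp hz).2)
  rw [h, map_inv]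

end ExtLevel

end Literature.AnabelianGeometry.AbsoluteAnabelian.AbsTopII.DehnTwist

end
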